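import Summits.CriticalPhenomena.SAWScalingLimit.Theorems.SAWLoopFugacityFlowAvoidanceLimitLandingLateral
import Summits.CriticalPhenomena.SAWScalingLimit.Theorems.SAWLoopFugacityFlowAvoidanceLimitSidePotentials
import Summits.CriticalPhenomena.SAWScalingLimit.Theorems.SAWLoopFugacityFlowAvoidanceLimitInwardBeurling
import Summits.CriticalPhenomena.SAWScalingLimit.Theorems.SAWLoopFugacityFlowAvoidanceLimitHitComparison
import Literature.Probability.LatticeModels.EdgeKilledBeurling
import HarnessLib

/-!
# Two-sidedness of the lateral harmonic measures in the middle ring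

Sub-problem `CriticalPhenomena/SAWScalingLimit`, crux `AvoidanceLimit`, line `symplectic-fermion-anchor`
(lead c7), stub `stub_germTwoSided`, hub existence (crux NOTES.md §"hcore blueprint (lead c6)" §7, RING
ESTIMATES). In the germ region `U' = germRegion D b s' g o` with lateral arcs
`α_T = D.boundary '' Icc σ' θ₁`, `α_B = D.boundary '' Icc θ₂ τ'` (nested germ arcs of
`exists_nested_germArcs`), the side potentials `h_X = killedPotential Ω^δ Θ' (sideSrc Ω^δ D δ α_X)`
(probability that the edge-killed walk of `Θ' = germSites D b s' g o δ` dies through an edge landing on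
`α_X`) satisfy `h_T(w) + h_B(w) ≥ 1 - ε` at every site `w` of the middle ring
`Λ₀ s ≤ |δw - b|∞`, `Λ₀ |δw - b|∞ ≤ s'`, eventually as `δ → 0`: by `one_sub_le_sidePotentials` the
deficit is at most (probability of leaving `Θ'` alive — through the outer gate, outward maneuver
`JordanDomain.edgeKilled_survive_le_pow` about `b`) + (probability of hitting a site with a landing
outside `α_T ∪ α_B` — by `edgeLanding_mem_lateral` such sites lie within `2δ` of `closedBox b s` or of
the outer gate arc: inward maneuver `edgeKilled_hitProb_inner_le_pow` about `b`, resp. outward again).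

Contents: three comparison lemmas for the edge-killed walk (subadditivity and screening of hitting
probabilities, domination by survival in a box closed for the region), the lattice bookkeeping about
`b` (rounding, exits/entrances of `Θ_δ(s)` sit next to the square, the gate arc is far from the
shrunken box), and the ring estimate `ring_twoSided` with `Λ₀ = 100 · 5^J`, `J = J(ε)`.

[cite: Chelkak2016, Lemma 3.4 and Proposition 3.3]
-/

noncomputable section

open scoped BigOperators Classical Topology
open Set Metric Filter
open Literature.Topology.PlaneTopology
open Literature.Probability.LatticeModels
open Literature.Probability.RandomPlanarGeometry (JordanDomain)

namespace Summit.CriticalPhenomena.SAWScalingLimit.Theorems.AvoidanceLimit.Anchor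

/-! ### Comparison lemmas for the edge-killed walk -/

/-- **Subadditivity of hitting probabilities**: `hitProb Λ (Y₁ ∪ Y₂) ≤ hitProb Λ Y₁ + hitProb Λ Y₂`
(the sum is nonnegative, killed-harmonic on `Λ ∖ (Y₁ ∪ Y₂)` and `≥ 1` on `Y₁ ∪ Y₂`; optional
stopping `mul_hitProb_le_of_superharmonic`). [folklore] -/
theorem hitProb_union_le {Gr : SimpleGraph (Site 2)} {Λ Y₁ Y₂ : Set (Site 2)} (hΛ : Λ.Finite)
    (w : Site 2) : hitProb Gr Λ (Y₁ ∪ Y₂) w ≤ hitProb Gr Λ Y₁ w + hitProb Gr Λ Y₂ w := by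
  have h1 : IsKilledHarmonicOn Gr (hitProb Gr Λ Y₁ + hitProb Gr Λ Y₂) (Λ \ (Y₁ ∪ Y₂)) :=
    ((hitProb_harmonicOn hΛ).mono fun z hz => ⟨hz.1, fun h => hz.2 (Or.inl h)⟩).add
      ((hitProb_harmonicOn hΛ).mono fun z hz => ⟨hz.1, fun h => hz.2 (Or.inr h)⟩)
  have key := mul_hitProb_le_of_superharmonic Gr Λ (Y₁ ∪ Y₂) (hitProb Gr Λ Y₁ + hitProb Gr Λ Y₂) 1
    hΛ zero_le_one (fun z => add_nonneg (hitProb_nonneg hΛ z) (hitProb_nonneg hΛ z))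
    h1.superharmonicOn (fun z hz => by
      rcases hz with hz | hz
      · rw [Pi.add_apply, hitProb_of_mem hz]; linarith [hitProb_nonneg (Gr := Gr) (B := Y₂) hΛ z]
      · rw [Pi.add_apply, hitProb_of_mem hz]; linarith [hitProb_nonneg (Gr := Gr) (B := Y₁) hΛ z]) w
  rwa [one_mul] at key

/-- **Screening of hitting probabilities.** If every kept edge from a site of `Λ ∖ B₁` into
`B₀ ∖ B₁` starts in `B₀` (the set `B₀ ∖ B₁` can only be entered through `B₀ ∪ B₁`), then off
`B₀` the probability of hitting `B₀` before leaving `Λ` is at most that of hitting `B₁`: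
comparison principle on `Λ ∖ (B₀ ∪ B₁)`. [folklore] -/
theorem hitProb_le_hitProb_of_screen {Gr : SimpleGraph (Site 2)} {Λ B₀ B₁ : Set (Site 2)}
    (hΛ : Λ.Finite) (hscreen : ∀ v ∈ Λ, v ∉ B₁ → ∀ z ∈ B₀, z ∉ B₁ → Gr.Adj v z → v ∈ B₀) :
    ∀ w, w ∉ B₀ → hitProb Gr Λ B₀ w ≤ hitProb Gr Λ B₁ w := by
  have hoff : ∀ z, z ∉ Λ \ (B₀ ∪ B₁) → z ∉ B₀ \ B₁ → hitProb Gr Λ B₀ z ≤ hitProb Gr Λ B₁ z := by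
    intro z hz hz'
    by_cases hzB₁ : z ∈ B₁
    · rw [hitProb_of_mem hzB₁]; exact hitProb_le_one hΛ z
    · have hzB₀ : z ∉ B₀ := fun h => hz' ⟨h, hzB₁⟩
      have hzΛ : z ∉ Λ := fun h => hz ⟨h, fun h' => h'.elim hzB₀ hzB₁⟩
      rw [hitProb_of_not_mem (fun h => hzΛ h.1), if_neg hzB₀]
      exact hitProb_nonneg hΛ z
  intro w hw
  by_cases hwS : w ∈ Λ \ (B₀ ∪ B₁)
  · have hSfin : (Λ \ (B₀ ∪ B₁)).Finite := hΛ.subset fun _ hz => hz.1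
    have h1 : IsKilledHarmonicOn Gr (hitProb Gr Λ B₀) (Λ \ (B₀ ∪ B₁)) :=
      (hitProb_harmonicOn hΛ).mono fun z hz => ⟨hz.1, fun h => hz.2 (Or.inl h)⟩
    have h2 : IsKilledHarmonicOn Gr (hitProb Gr Λ B₁) (Λ \ (B₀ ∪ B₁)) :=
      (hitProb_harmonicOn hΛ).mono fun z hz => ⟨hz.1, fun h => hz.2 (Or.inr h)⟩
    refine le_of_killedSub_killedSuper_of_boundary hSfin h1.subharmonicOn h2.superharmonicOn ?_ w hwS
    rintro _ ⟨hzS, v, hv, e, rfl, hadj⟩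
    exact hoff _ hzS fun hzB =>
      hv.2 (Or.inl (hscreen v hv.1 (fun h => hv.2 (Or.inr h)) _ hzB.1 hzB.2 hadj))
  · exact hoff w hwS fun h => hw h.1

/-- **A box closed for the region bounds through survival.** Let `Λ`, `W` be finite and suppose
no kept edge leads from `Λ ∩ W` to `W ∖ Λ` (inside `W`, the walk of `Λ` can only leave `Λ` by
leaving `W`). Then every function `h ≤ 1` killed-harmonic on `Λ ∩ W` is at most
`edgeSurvive Gr W` on `Λ ∩ W`: the exits of `Λ ∩ W` lie off `W`, where `edgeSurvive Gr W = 1`.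
[folklore] -/
theorem le_edgeSurvive_of_closed {Gr : SimpleGraph (Site 2)} {Λ W : Set (Site 2)} (hΛ : Λ.Finite)
    (hW : W.Finite) (hclosed : ∀ v ∈ Λ ∩ W, ∀ z ∈ W, Gr.Adj v z → z ∈ Λ) {h : Site 2 → ℝ}
    (hh : IsKilledHarmonicOn Gr h (Λ ∩ W)) (hh1 : ∀ z, h z ≤ 1) :
    ∀ w ∈ Λ ∩ W, h w ≤ edgeSurvive Gr W w := by
  refine le_of_killedSub_killedSuper_of_boundary (hΛ.subset inter_subset_left) hh.subharmonicOn
    ((killedHarmExt_harmonicOn hW _).mono inter_subset_right).superharmonicOn ?_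
  rintro _ ⟨hzS, v, hv, e, rfl, hadj⟩
  have hzW : v + SRW.stepVec e ∉ W := fun hzW => hzS ⟨hclosed v hv _ hzW hadj, hzW⟩
  rw [edgeSurvive_of_not_mem hzW]
  exact hh1 _

/-! ### Lattice geometry about the boundary point -/

/-- Rounding: the lattice site nearest to `b/δ` is within `1/2` of it in each coordinate.
[folklore] -/
theorem abs_div_sub_nearestSite_le (δ : ℝ) (b : ℂ) :
    |b.re / δ - (nearestSite δ b 0 : ℝ)| ≤ 1 / 2 ∧ |b.im / δ - (nearestSite δ b 1 : ℝ)| ≤ 1 / 2 := by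
  simp only [nearestSite, Matrix.cons_val_zero, Matrix.cons_val_one]
  exact ⟨abs_sub_round _, abs_sub_round _⟩

/-- Mesh coordinates versus lattice coordinates: if `|t/δ - m| ≤ 1/2` then
`δ (|x - m| - 1/2) ≤ |δ x - t| ≤ δ (|x - m| + 1/2)`. [folklore] -/
theorem abs_mesh_coord {δ t : ℝ} (hδ : 0 < δ) {m : ℤ} (hm : |t / δ - m| ≤ 1 / 2) (x : ℤ) :
    δ * (|(x : ℝ) - m| - 1 / 2) ≤ |δ * x - t| ∧ |δ * x - t| ≤ δ * (|(x : ℝ) - m| + 1 / 2) := by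
  have e : |δ * x - t| = δ * |(x : ℝ) - t / δ| := by
    rw [← abs_of_pos hδ, ← abs_mul, abs_of_pos hδ, mul_sub, mul_div_cancel₀ _ hδ.ne']
  have h1 := abs_sub_abs_le_abs_sub ((x : ℝ) - m) ((x : ℝ) - t / δ)
  have h2 := abs_sub_abs_le_abs_sub ((x : ℝ) - t / δ) ((x : ℝ) - m)
  rw [show (x : ℝ) - m - ((x : ℝ) - t / δ) = t / δ - m by ring] at h1
  rw [show (x : ℝ) - t / δ - ((x : ℝ) - m) = -(t / δ - m) by ring, abs_neg] at h2
  rw [e]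
  exact ⟨mul_le_mul_of_nonneg_left (by linarith) hδ.le, mul_le_mul_of_nonneg_left (by linarith) hδ.le⟩

/-- Consequently `|x - m| ≤ R/δ + 1/2` whenever `|δ x - t| ≤ R`. [folklore] -/
theorem abs_sub_le_of_mesh {δ t : ℝ} (hδ : 0 < δ) {m : ℤ} (hm : |t / δ - m| ≤ 1 / 2) {x : ℤ} {R : ℝ}
    (h : |δ * x - t| ≤ R) : |(x : ℝ) - m| ≤ R / δ + 1 / 2 := by
  have := (abs_mesh_coord hδ hm x).1.trans h
  rw [mul_comm, ← le_div_iff₀ hδ] at this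
  linarith

/-- **Exits of `Θ_δ(s)` are near the square**: a site off `Θ_δ(s)` joined to `Θ_δ(s)` by a kept
edge has its mesh point off the open box of radius `s - δ` (`sup_norm_germExit`). [folklore] -/
theorem not_mem_box_of_adj_of_not_mem_germSites {D : JordanDomain} {b : ℂ} {s : ℝ} {hs : 0 < s}
    {g o : ℂ} {δ : ℝ} (h2 : TwoOff D (boxJD b hs))
    (hg : g ∈ D.carrier ∩ Literature.Topology.PlaneTopology.box b s) (ho : o ∈ D.carrier)
    (hoc : o ∉ closedBox b s) (hδ : 0 < δ) {v z : Site 2} (hv : v ∈ germSites D b hs g o δ)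
    (hz : z ∉ germSites D b hs g o δ) (hadj : (discreteDomainGraph D.carrier δ).Adj v z) :
    meshPoint δ z ∉ Literature.Topology.PlaneTopology.box b (s - δ) := by
  obtain ⟨e, rfl⟩ := SRW.exists_dir_of_adj
    (meshGraph_le_zdGraph _ _ (discreteDomainGraph_le_meshGraph _ _ hadj))
  exact (sup_norm_germExit h2 hg ho hoc hδ ⟨hz, v, hv, e, rfl, hadj⟩).2

/-- **Entering `Θ_δ(s)` happens near the square**: a site off `Θ_δ(s)` joined to `Θ_δ(s)` by a
kept edge has its mesh point in the closed box of radius `s + δ` (`sup_norm_germExit`). [folklore] -/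
theorem mem_closedBox_of_adj_of_mem_germSites {D : JordanDomain} {b : ℂ} {s : ℝ} {hs : 0 < s}
    {g o : ℂ} {δ : ℝ} (h2 : TwoOff D (boxJD b hs))
    (hg : g ∈ D.carrier ∩ Literature.Topology.PlaneTopology.box b s) (ho : o ∈ D.carrier)
    (hoc : o ∉ closedBox b s) (hδ : 0 < δ) {v z : Site 2} (hv : v ∉ germSites D b hs g o δ)
    (hz : z ∈ germSites D b hs g o δ) (hadj : (discreteDomainGraph D.carrier δ).Adj v z) :
    meshPoint δ v ∈ closedBox b (s + δ) := by
  obtain ⟨e, rfl⟩ := SRW.exists_dir_of_adj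
    (meshGraph_le_zdGraph _ _ (discreteDomainGraph_le_meshGraph _ _ hadj.symm))
  exact (sup_norm_germExit h2 hg ho hoc hδ ⟨hv, z, hz, e, rfl, hadj.symm⟩).1

/-- **Points of the box of radius `s' - 2δ` are at distance `> 2δ` from the gate arc** (which lies
on the square of radius `s'`). [folklore] -/
theorem two_mul_lt_dist_gateArc {D : JordanDomain} {b : ℂ} {s' : ℝ} (hs' : 0 < s') (t₀ : ℝ) {δ : ℝ}
    {p : ℂ} (hp : p ∈ Literature.Topology.PlaneTopology.box b (s' - 2 * δ)) :
    ∀ z ∈ gateArc D (boxJD b hs') t₀, 2 * δ < dist p z := by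
  intro z hz
  by_contra hle
  push Not at hle
  have hzsq : z ∈ closedBox b s' \ Literature.Topology.PlaneTopology.box b s' :=
    range_boxJD_boundary b hs' ▸ gateArc_subset_range t₀ hz
  apply hzsq.2
  rw [mem_box_iff_abs] at hp ⊢
  have hn : dist p z = ‖p - z‖ := dist_eq_norm p z
  have hre : |p.re - z.re| ≤ dist p z := by
    rw [hn, ← Complex.sub_re]; exact Complex.abs_re_le_norm _
  have him : |p.im - z.im| ≤ dist p z := by
    rw [hn, ← Complex.sub_im]; exact Complex.abs_im_le_norm _
  constructor
  · calc |z.re - b.re| = |(p.re - b.re) - (p.re - z.re)| := by ring_nf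
      _ ≤ |p.re - b.re| + |p.re - z.re| := abs_sub _ _
      _ < s' := by linarith [hp.1]
  · calc |z.im - b.im| = |(p.im - b.im) - (p.im - z.im)| := by ring_nf
      _ ≤ |p.im - b.im| + |p.im - z.im| := abs_sub _ _
      _ < s' := by linarith [hp.2]

/-- Arithmetic of the inward maneuver: the start site is off the box of radius `24·5^J k`.
[folklore] -/
theorem arith_inner {F s δ kr A : ℝ} (hF : 1 ≤ F) (hδ : 0 < δ) (hδs : δ ≤ s)
    (hk : kr < s / δ + 2) (hA : 100 * F * s ≤ δ * (A + 1 / 2)) : 24 * F * kr < A := by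
  have h1 : kr * δ < s + 2 * δ := by
    have := (lt_div_iff₀ hδ).1 (show kr - 2 < s / δ by linarith)
    linarith
  have h2 : F * (kr * δ) ≤ F * (s + 2 * δ) := mul_le_mul_of_nonneg_left h1.le (by linarith)
  have h3 : F * δ ≤ F * s := mul_le_mul_of_nonneg_left hδs (by linarith)
  have h4 : s ≤ F * s := le_mul_of_one_le_left (by linarith) hF
  have h5 : δ * (24 * F * kr) < δ * A := by nlinarith
  exact lt_of_mul_lt_mul_left h5 hδ.le

/-- Arithmetic of the outward maneuver: the box of radius `48·5^J k'` stays inside the box of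
radius `s' - 2δ`. [folklore] -/
theorem arith_outer {F δ ρ s' kr : ℝ} (hF : 1 ≤ F) (hδ : 0 < δ) (hρ : 100 * F * δ ≤ ρ)
    (hs' : 100 * F * ρ ≤ s') (hk : kr < ρ / δ + 2) : δ * (48 * (F * kr) + 1 / 2) < s' - 2 * δ := by
  have h1 : kr * δ < ρ + 2 * δ := by
    have := (lt_div_iff₀ hδ).1 (show kr - 2 < ρ / δ by linarith)
    linarith
  have h2 : F * (kr * δ) ≤ F * (ρ + 2 * δ) := mul_le_mul_of_nonneg_left h1.le (by linarith)
  have h3 : ρ ≤ F * ρ := le_mul_of_one_le_left (by nlinarith) hF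
  have h4 : δ ≤ F * δ := le_mul_of_one_le_left hδ.le hF
  nlinarith

/-! ### The ring estimate -/

/-- **Ring two-sidedness of the lateral side potentials.** See the module docstring: with
`J = J(ε)` annuli both maneuver bounds are `≤ ε/3`, `Λ₀ = 100 · 5^J`; for `δ < s` the deficit
`1 - h_T - h_B ≤ edgeSurvive Θ' + hitProb Θ' (B₀ ∪ Y_out)` (`one_sub_le_sidePotentials`,
`edgeLanding_mem_lateral`), `B₀ = Θ(s) ∪ {sites in closedBox b (s + 2δ)}` is screened by the lattice
box of radius `12k ≍ s/δ` about `b/δ` (inward maneuver), and `Y_out = {sites off box b (s' - 2δ)}`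
together with the exits of `Θ'` lies outside the box of radius `48·5^J k'`, `k' ≍ |δw - b|∞/δ`
(outward maneuver). [cite: Chelkak2016, Lemma 3.4] -/
theorem ring_twoSided :
    ∀ ε : ℝ, 0 < ε → ∃ Λ₀ : ℝ, 1 < Λ₀ ∧
    ∀ (D : JordanDomain), ∀ b ∈ frontier D.carrier, ∀ (s s' : ℝ) (hs : 0 < s) (hs' : 0 < s'), s < s' →
    ∀ (g o : ℂ), TwoOff D (boxJD b hs) → TwoOff D (boxJD b hs') →
      g ∈ D.carrier ∩ Literature.Topology.PlaneTopology.box b s → o ∈ D.carrier → o ∉ closedBox b s' →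
    ∀ (σ' θ₁ θ₂ τ' : ℝ), σ' < θ₁ → θ₁ < θ₂ → θ₂ < τ' → τ' < σ' + 1 →
      frontier (germRegion D b hs' g o) =
        gateArc D (boxJD b hs') (germGateParam D b hs' g o) ∪ D.boundary '' Set.Icc σ' τ' →
      frontier (germRegion D b hs g o) =
        gateArc D (boxJD b hs) (germGateParam D b hs g o) ∪ D.boundary '' Set.Icc θ₁ θ₂ →
      ({D.boundary θ₁, D.boundary θ₂} : Set ℂ) =
        {(boxJD b hs).boundary (gateLo D (boxJD b hs) (germGateParam D b hs g o)),
         (boxJD b hs).boundary (gateHi D (boxJD b hs) (germGateParam D b hs g o))} →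
    ∀ᶠ δ in 𝓝[>] (0 : ℝ), ∀ w ∈ germSites D b hs' g o δ, w ∉ germSites D b hs g o δ →
      Λ₀ * s ≤ max |(meshPoint δ w).re - b.re| |(meshPoint δ w).im - b.im| →
      Λ₀ * max |(meshPoint δ w).re - b.re| |(meshPoint δ w).im - b.im| ≤ s' →
      1 - ε ≤ killedPotential (discreteDomainGraph D.carrier δ) (germSites D b hs' g o δ)
              (sideSrc (discreteDomainGraph D.carrier δ) D.carrier δ (D.boundary '' Set.Icc σ' θ₁)) w +
            killedPotential (discreteDomainGraph D.carrier δ) (germSites D b hs' g o δ)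
              (sideSrc (discreteDomainGraph D.carrier δ) D.carrier δ (D.boundary '' Set.Icc θ₂ τ')) w := by
  intro ε hε
  -- the constants: `J` annuli make both maneuver bounds `≤ ε / 3`; `Λ₀ = 100 · 5^J`
  obtain ⟨cin, hcin0, hcin1, hinner⟩ := edgeKilled_hitProb_inner_le_pow
  set q : ℝ := max (1 - cin) (1 - maneuverConst) with hq
  have hq0 : 0 ≤ q := le_max_of_le_left (by linarith)
  have hq1 : q < 1 := max_lt (by linarith) (by linarith [maneuverConst_pos])
  obtain ⟨J, hJ⟩ := exists_pow_lt_of_lt_one (show 0 < ε / 3 by positivity) hq1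
  have hqJ : q ^ (J + 1) ≤ ε / 3 := (pow_le_pow_of_le_one hq0 hq1.le (Nat.le_succ J)).trans hJ.le
  have hinJ : (1 - cin) ^ (J + 1) ≤ ε / 3 :=
    (pow_le_pow_left₀ (by linarith) (le_max_left _ _) _).trans hqJ
  have houtJ : (1 - maneuverConst) ^ (J + 1) ≤ ε / 3 :=
    (pow_le_pow_left₀ (by linarith [maneuverConst_le_one]) (le_max_right _ _) _).trans hqJ
  set F : ℝ := (5 : ℝ) ^ J with hF
  have hF1 : (1 : ℝ) ≤ F := one_le_pow₀ (by norm_num)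
  refine ⟨100 * F, by linarith, ?_⟩
  intro D b hb s s' hs hs' hss' g o h2 h2' hg ho hoc σ' θ₁ θ₂ τ' hσθ hθθ hθτ hτσ hfU' hfU hends
  have hg' : g ∈ D.carrier ∩ Literature.Topology.PlaneTopology.box b s' := ⟨hg.1, box_mono hss'.le hg.2⟩
  have hoc_s : o ∉ closedBox b s := fun h => hoc (closedBox_mono hss'.le h)
  have hAB : Disjoint (D.boundary '' Icc σ' θ₁) (D.boundary '' Icc θ₂ τ') := by
    rw [Set.disjoint_left]
    rintro _ ⟨t₁, ht₁, rfl⟩ ⟨t₂, ht₂, he⟩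
    have := D.injOn_boundary_Ico σ' ⟨ht₁.1, by linarith [ht₁.2]⟩
      ⟨by linarith [ht₂.1], by linarith [ht₂.2]⟩ he.symm
    linarith [ht₁.2, ht₂.1]
  filter_upwards [eventually_mem_nhdsWithin, (eventually_lt_nhds hs).filter_mono nhdsWithin_le_nhds]
    with δ hδ hδs
  replace hδ : 0 < δ := hδ
  intro w hw hwΘ hρ1 hρ2
  set Gr := discreteDomainGraph D.carrier δ
  set Θ' := germSites D b hs' g o δ
  set Θ := germSites D b hs g o δ
  set ρ := max |(meshPoint δ w).re - b.re| |(meshPoint δ w).im - b.im|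
  have hΘ'fin : Θ'.Finite := germSites_finite hδ
  have hΘΘ' : Θ ⊆ Θ' := germSites_mono hss' h2 h2' hg ho hoc
  have hρF : 100 * F * δ ≤ ρ := (mul_le_mul_of_nonneg_left hδs.le (by positivity)).trans hρ1
  -- the lattice centre
  obtain ⟨c, hc0, hc1⟩ : ∃ c : Site 2, |b.re / δ - c 0| ≤ 1 / 2 ∧ |b.im / δ - c 1| ≤ 1 / 2 :=
    ⟨_, abs_div_sub_nearestSite_le δ b⟩
  have hw0 := abs_mesh_coord hδ hc0 (w 0)
  have hw1 := abs_mesh_coord hδ hc1 (w 1)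
  rw [← meshPoint_re δ w] at hw0
  rw [← meshPoint_im δ w] at hw1
  -- the exceptional sets
  set C : Set (Site 2) := {y | y ∈ Θ' ∧ meshPoint δ y ∈ closedBox b (s + 2 * δ)}
  set B₀ : Set (Site 2) := Θ ∪ C
  set Yout : Set (Site 2) :=
    {y | y ∈ Θ' ∧ meshPoint δ y ∉ Literature.Topology.PlaneTopology.box b (s' - 2 * δ)}
  -- (1) side-potential bookkeeping: deaths off the lateral arcs happen in `B₀ ∪ Yout`
  have hY : ∀ y ∈ Θ', ∀ e : SRW.Dir 2,
      landsIn Gr D.carrier δ (D.boundary '' Icc σ' θ₁ ∪ D.boundary '' Icc θ₂ τ')ᶜ y e → y ∈ B₀ ∪ Yout := by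
    intro y hy e hland
    by_contra hnot
    simp only [mem_union, not_or] at hnot
    have hybox : meshPoint δ y ∉ closedBox b (s + 2 * δ) := fun h => hnot.1 (Or.inr ⟨hy, h⟩)
    have hyin : meshPoint δ y ∈ Literature.Topology.PlaneTopology.box b (s' - 2 * δ) := by
      by_contra h; exact hnot.2 ⟨hy, h⟩
    exact hland.2 (edgeLanding_mem_lateral D b s s' hs hs' hss' g o h2 h2' hg ho hoc σ' θ₁ θ₂ τ' hσθ hθθ
      hθτ hτσ hfU' hfU hends δ hδ y hy (fun h => hnot.1 (Or.inl h)) hybox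
      (two_mul_lt_dist_gateArc hs' _ hyin) e hland.1)
  have step1 := one_sub_le_sidePotentials Gr D.carrier δ Θ' hΘ'fin _ _ hAB (B₀ ∪ Yout) hY w hw
  clear hY hfU' hfU hends hAB
  -- (2) subadditivity
  have step2 := hitProb_union_le (Gr := Gr) (Λ := Θ') (Y₁ := B₀) (Y₂ := Yout) hΘ'fin w
  -- (3) the inner part: inward maneuver about `b` at scale `k`
  obtain ⟨k, hk0, hkr1, hkr2⟩ : ∃ k : ℕ, 0 < k ∧ s / δ + 1 ≤ k ∧ (k : ℝ) < s / δ + 2 :=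
    ⟨⌈s / δ⌉₊ + 1, Nat.succ_pos _, by push_cast; linarith [Nat.le_ceil (s / δ)],
      by push_cast; linarith [Nat.ceil_lt_add_one (show 0 ≤ s / δ by positivity)]⟩
  have hkr0 : (1 : ℝ) ≤ k := by exact_mod_cast hk0
  have hbk0 : |b.re / δ - c 0| < 12 * k := hc0.trans_lt (by linarith)
  have hbk1 : |b.im / δ - c 1| < 12 * k := hc1.trans_lt (by linarith)
  have hCmB : C ⊆ mB c k := by
    rintro y ⟨-, hy⟩
    rw [mem_closedBox, meshPoint_re, meshPoint_im] at hy
    obtain ⟨hy1, hy2, hy3, hy4⟩ := hy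
    have f0 := abs_sub_le_of_mesh hδ hc0 (abs_le.2 ⟨by linarith, by linarith⟩ : |δ * (y 0 : ℝ) - b.re| ≤ s + 2 * δ)
    have f1 := abs_sub_le_of_mesh hδ hc1 (abs_le.2 ⟨by linarith, by linarith⟩ : |δ * (y 1 : ℝ) - b.im| ≤ s + 2 * δ)
    have hsd : (s + 2 * δ) / δ + 1 / 2 ≤ 12 * k := by rw [add_div, mul_div_cancel_right₀ _ hδ.ne']; linarith
    exact ⟨by exact_mod_cast f0.trans hsd, by exact_mod_cast f1.trans hsd⟩
  have hwsq : w ∉ WeakBeurling.sqBox c (24 * 5 ^ J * k) := by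
    rw [WeakBeurling.mem_sqBox, not_and_or, not_le, not_le]
    rcases le_max_iff.1 hρ1 with h | h
    · left
      have : (24 : ℝ) * F * k < |(w 0 : ℝ) - c 0| := arith_inner hF1 hδ hδs.le hkr2 (h.trans hw0.2)
      rw [hF] at this
      exact_mod_cast this
    · right
      have : (24 : ℝ) * F * k < |(w 1 : ℝ) - c 1| := arith_inner hF1 hδ hδs.le hkr2 (h.trans hw1.2)
      rw [hF] at this
      exact_mod_cast this
  have hscreen : ∀ v ∈ Θ', v ∉ mB c k → ∀ z ∈ B₀, z ∉ mB c k → Gr.Adj v z → v ∈ B₀ := by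
    intro v hv _ z hz hzmB hadj
    have hzΘ : z ∈ Θ := hz.resolve_right fun hzC => hzmB (hCmB hzC)
    by_cases hvΘ : v ∈ Θ
    · exact Or.inl hvΘ
    · exact Or.inr ⟨hv, closedBox_mono (by linarith)
        (mem_closedBox_of_adj_of_mem_germSites h2 hg ho hoc_s hδ hvΘ hzΘ hadj)⟩
  have hwB₀ : w ∉ B₀ := by
    rintro (h | ⟨-, h⟩)
    · exact hwΘ h
    · rw [mem_closedBox] at h
      obtain ⟨h1, h2, h3, h4⟩ := h
      have : ρ ≤ s + 2 * δ :=
        max_le (abs_le.2 ⟨by linarith, by linarith⟩) (abs_le.2 ⟨by linarith, by linarith⟩)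
      have : s ≤ F * s := le_mul_of_one_le_left hs.le hF1
      linarith
  have hin : hitProb Gr Θ' B₀ w ≤ ε / 3 :=
    (hitProb_le_hitProb_of_screen hΘ'fin hscreen w hwB₀).trans
      ((hinner D δ hδ b hb c k hk0 hbk0 hbk1 J Θ' hΘ'fin w hwsq).trans hinJ)
  clear hinner hscreen hwsq hCmB hbk0 hbk1 hkr0 hkr1 hkr2
  -- (4) the outer part: outward maneuver about `b` from scale `k'`
  obtain ⟨k', hk'0, hk'r1, hk'r2⟩ : ∃ k' : ℕ, 0 < k' ∧ ρ / δ + 1 ≤ k' ∧ (k' : ℝ) < ρ / δ + 2 :=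
    ⟨⌈ρ / δ⌉₊ + 1, Nat.succ_pos _, by push_cast; linarith [Nat.le_ceil (ρ / δ)],
      by push_cast; linarith [Nat.ceil_lt_add_one (show 0 ≤ ρ / δ by positivity)]⟩
  have hk'r0 : (1 : ℝ) ≤ k' := by exact_mod_cast hk'0
  have hbk'0 : |b.re / δ - c 0| < 12 * k' := hc0.trans_lt (by linarith)
  have hbk'1 : |b.im / δ - c 1| < 12 * k' := hc1.trans_lt (by linarith)
  have hwmB : w ∈ mB c k' := by
    have e0 : |δ * (w 0 : ℝ) - b.re| ≤ ρ := by rw [← meshPoint_re]; exact le_max_left _ _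
    have e1 : |δ * (w 1 : ℝ) - b.im| ≤ ρ := by rw [← meshPoint_im]; exact le_max_right _ _
    have hρδ : ρ / δ + 1 / 2 ≤ 12 * k' := by linarith
    exact ⟨by exact_mod_cast (abs_sub_le_of_mesh hδ hc0 e0).trans hρδ,
      by exact_mod_cast (abs_sub_le_of_mesh hδ hc1 e1).trans hρδ⟩
  set W : Set (Site 2) := mW c (5 ^ J * k')
  have hWfin : W.Finite := mW_finite c _
  have key : δ * (48 * (F * k') + 1 / 2) < s' - 2 * δ := arith_outer hF1 hδ hρF hρ2 hk'r2
  have hWbox : ∀ x ∈ W, meshPoint δ x ∈ Literature.Topology.PlaneTopology.box b (s' - 2 * δ) := by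
    rintro x ⟨hx0, hx1⟩
    have hx0' : |(x 0 : ℝ) - c 0| ≤ 48 * (F * k') := by
      rw [hF]; exact_mod_cast hx0
    have hx1' : |(x 1 : ℝ) - c 1| ≤ 48 * (F * k') := by
      rw [hF]; exact_mod_cast hx1
    rw [mem_box_iff_abs, meshPoint_re, meshPoint_im]
    exact ⟨((abs_mesh_coord hδ hc0 (x 0)).2.trans
        (mul_le_mul_of_nonneg_left (add_le_add hx0' le_rfl) hδ.le)).trans_lt key,
      ((abs_mesh_coord hδ hc1 (x 1)).2.trans
        (mul_le_mul_of_nonneg_left (add_le_add hx1' le_rfl) hδ.le)).trans_lt key⟩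
  have hclosed : ∀ v ∈ Θ' ∩ W, ∀ z ∈ W, Gr.Adj v z → z ∈ Θ' := by
    intro v hv z hz hadj
    by_contra hzΘ
    exact not_mem_box_of_adj_of_not_mem_germSites h2' hg' ho hoc hδ hv.1 hzΘ hadj
      (box_mono (by linarith) (hWbox z hz))
  have hwW : w ∈ Θ' ∩ W :=
    ⟨hw, mB_subset_mW (mB_subset_mB_of_le c (Nat.le_mul_of_pos_left k' (pow_pos (by norm_num) J)) hwmB)⟩
  have hsurvW : edgeSurvive Gr W w ≤ ε / 3 :=
    (D.edgeKilled_survive_le_pow hδ hb J c k' hk'0 hbk'0 hbk'1 w hwmB).trans houtJ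
  have hsurv : edgeSurvive Gr Θ' w ≤ ε / 3 :=
    (le_edgeSurvive_of_closed hΘ'fin hWfin hclosed
      ((killedHarmExt_harmonicOn hΘ'fin _).mono inter_subset_left)
      (fun z => (edgeSurvive_mem_Icc hΘ'fin z).2) w hwW).trans hsurvW
  have hout : hitProb Gr Θ' Yout w ≤ ε / 3 :=
    (le_edgeSurvive_of_closed hΘ'fin hWfin hclosed
      ((hitProb_harmonicOn hΘ'fin).mono fun z hz => ⟨hz.1, fun hzY => hzY.2 (hWbox z hz.2)⟩)
      (fun z => hitProb_le_one hΘ'fin z) w hwW).trans hsurvW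
  linarith

end Summit.CriticalPhenomena.SAWScalingLimit.Theorems.AvoidanceLimit.Anchor

end
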